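import Summits.HubbardSuperconductivity.HubbardSuperconductivity.Theses.LiebTwin
import Summits.HubbardSuperconductivity.HubbardSuperconductivity.Theorems.LiebTwinDWavePolarisedDiscordanceStubChannelCompleteness
import Summits.HubbardSuperconductivity.HubbardSuperconductivity.Theorems.LiebTwinDWavePolarisedDiscordanceStubMassFeedsOfCrux
import HarnessLib

/-!
# Route `LiebTwin`, crux `DWavePolarisedDiscordance` (stmt-HubbardSuperconductivity-15314), line `Sketch`:
# the two budgets alone give bond locality K3″ (helper, `--supports`, stub `stub_bondLocality_of_budgets`)

Line `Sketch` (card `Ideas/channel-exhaustion-sum-rule.md`, skeleton `Cruxes/DWavePolarisedDiscordance/Lines/Sketch.lean`)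
proves the crux K3′ from `stub_leakBound` (∃η<2: `32·Leak ≤ η·m + εL⁴`), `stub_exoticBudget` (∃θ<2:
`8·Exotic ≤ θ·m + εL⁴`) and the sibling crux `NoOnsiteODLRO`, through the conservation law `Tr G = −4·Leak` (landed
`LiebTwinChannelExhaustion.stub_channelCompleteness`, p163800). This file records WHERE the two physics budgets sit
relative to the restatement K3″ recommended by lead c1 (`κ·m − εL⁴ ≤ F_d(φ) + F_xs(φ)`, the statement of the registered
stub `stub_massFeedsBondSinglets`, which closes the route with K2 and NoOnsite: `LiebTwinBondLocality.hubbardSuperconductivity_of_bondLocality`,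
p153625): **the two budgets imply K3″ with κ = 4 − η − θ, WITHOUT `NoOnsiteODLRO`** — from
`D − D′ = 8·TrG + 4m − (X − X′) − 8·Exotic = −32·Leak + 4m − (X − X′) − 8·Exotic` one gets
`D + X = 4m − 32·Leak − 8·Exotic + D′ + X′ ≥ (4 − η − θ)·m − 2εL⁴` since `D′, X′ ≥ 0`. So the line's open content
(the budgets) is at least as strong as K3″, and K3′ = K3″-content + the extended-`s` sink (NoOnsite). No definition,
no named fact, no `sorry`. [folklore]
-/

-- the mandated namespace `Summit.<Summit>.<Problem>.Theorems` repeats `HubbardSuperconductivity` (D-0017)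
set_option linter.dupNamespace false

noncomputable section

namespace Summit.HubbardSuperconductivity.HubbardSuperconductivity.Theorems.LiebTwinChannelExhaustion

open Matrix Finset Literature.MathematicalPhysics.QuantumLattice Literature.Probability.LatticeModels
open scoped ComplexOrder MatrixOrder Matrix.Norms.L2Operator

/-- **STUB `stub_bondLocality_of_budgets`** of crux `DWavePolarisedDiscordance` (stmt-HubbardSuperconductivity-15314), line `Sketch`:
the leak budget and the exotic budget (the two physics stubs of the line, taken as hypotheses VERBATIM) imply bond locality
K3″ (`κ·m − εL⁴ ≤ F_d(φ) + F_xs(φ)`, the statement of `stub_massFeedsBondSinglets`) with `κ = 4 − η − θ`, by the conservation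
law `Tr G = −4·Leak` and `F_d(φ̃), F_xs(φ̃) ≥ 0` — no `NoOnsiteODLRO` needed. [folklore] -/
theorem stub_bondLocality_of_budgets :
    open Literature.MathematicalPhysics.QuantumLattice Literature.Probability.LatticeModels in
    open scoped MatrixOrder Matrix.Norms.L2Operator in
    (∀ U ∈ Set.Ioc (0 : ℝ) 4, ∀ δ ∈ Set.Icc (1 / 10 : ℝ) (3 / 10), ∃ η : ℝ, η < 2 ∧ ∀ ε : ℝ, 0 < ε →
        ∃ L₀ : ℕ, ∀ (L : ℕ) [NeZero L], L₀ ≤ L → Even L → ∀ n : ℕ, n = ⌊(1 - δ) * (L : ℝ) ^ 2 / 2⌋₊ →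
          ∀ φ : Fock (Orb (FermionTorus 2 L)), star φ ⬝ᵥ φ = 1 →
            IsGroundStateInSector (hubbardTorus 2 L 1 U) (2 * n) 0 φ →
              ∀ (W A : Matrix (Config (FermionTorus 2 L) n) (Config (FermionTorus 2 L) n) ℂ)
                (T : TorusSite 2 L → Matrix (Config (FermionTorus 2 L) n) (Config (FermionTorus 2 L) n) ℂ),
                W = liebW n φ → A = CFC.abs W →
                  (T = fun a => ∑ x : TorusSite 2 L,
                    configHop n (FermionTorus.ofTorusSite x) (FermionTorus.ofTorusSite (x + a))) →
                    8 * (∑ a : TorusSite 2 L,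
                        ((Aᴴ * T a * A * (T a)ᵀ).trace - (Wᴴ * T a * W * (T a)ᵀ).trace)).re ≤
                      η * ((expect ((pairField sWave L)ᴴ * pairField sWave L) (liebVec n A)).re -
                            (expect ((pairField sWave L)ᴴ * pairField sWave L) φ).re) +
                        ε * (L : ℝ) ^ 4) →
    (∀ U ∈ Set.Ioc (0 : ℝ) 4, ∀ δ ∈ Set.Icc (1 / 10 : ℝ) (3 / 10), ∃ θ : ℝ, θ < 2 ∧ ∀ ε : ℝ, 0 < ε →
        ∃ L₀ : ℕ, ∀ (L : ℕ) [NeZero L], L₀ ≤ L → Even L → ∀ n : ℕ, n = ⌊(1 - δ) * (L : ℝ) ^ 2 / 2⌋₊ →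
          ∀ φ : Fock (Orb (FermionTorus 2 L)), star φ ⬝ᵥ φ = 1 →
            IsGroundStateInSector (hubbardTorus 2 L 1 U) (2 * n) 0 φ →
              ∀ (W A : Matrix (Config (FermionTorus 2 L) n) (Config (FermionTorus 2 L) n) ℂ)
                (φt : Fock (Orb (FermionTorus 2 L)))
                (B : TorusSite 2 L → TorusSite 2 L →
                  Matrix (Config (FermionTorus 2 L) n) (Config (FermionTorus 2 L) n) ℂ),
                W = liebW n φ → A = CFC.abs W → φt = liebVec n A →
                  (B = fun x x' => configHop n (FermionTorus.ofTorusSite x) (FermionTorus.ofTorusSite x')) →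
                    ∀ trG m dgain xgain : ℝ,
                      trG = (∑ r : TorusSite 2 L, ∑ x : TorusSite 2 L, ∑ x' : TorusSite 2 L,
                        ((Wᴴ * B x x' * W * (B (x + r) (x' + r))ᵀ).trace -
                          (Aᴴ * B x x' * A * (B (x + r) (x' + r))ᵀ).trace)).re →
                      m = (expect ((pairField sWave L)ᴴ * pairField sWave L) φt).re -
                        (expect ((pairField sWave L)ᴴ * pairField sWave L) φ).re →
                      dgain = (expect ((pairField dWaveFormFactor L)ᴴ * pairField dWaveFormFactor L) φ).re -
                        (expect ((pairField dWaveFormFactor L)ᴴ * pairField dWaveFormFactor L) φt).re →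
                      xgain = (expect ((pairField extendedSWave L)ᴴ * pairField extendedSWave L) φ).re -
                        (expect ((pairField extendedSWave L)ᴴ * pairField extendedSWave L) φt).re →
                        8 * trG + 4 * m - dgain - xgain ≤ θ * m + ε * (L : ℝ) ^ 4) →
      ∀ U ∈ Set.Ioc (0 : ℝ) 4, ∀ δ ∈ Set.Icc (1 / 10 : ℝ) (3 / 10), ∃ κ : ℝ, 0 < κ ∧ ∀ ε : ℝ, 0 < ε →
        ∃ L₀ : ℕ, ∀ (L : ℕ) [NeZero L], L₀ ≤ L → Even L → ∀ φ : Fock (Orb (FermionTorus 2 L)),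
          star φ ⬝ᵥ φ = 1 →
            IsGroundStateInSector (hubbardTorus 2 L 1 U) (2 * ⌊(1 - δ) * (L : ℝ) ^ 2 / 2⌋₊) 0 φ →
              κ * ((expect ((pairField sWave L)ᴴ * pairField sWave L)
                      (liebVec ⌊(1 - δ) * (L : ℝ) ^ 2 / 2⌋₊
                        (CFC.abs (liebW ⌊(1 - δ) * (L : ℝ) ^ 2 / 2⌋₊ φ)))).re -
                    (expect ((pairField sWave L)ᴴ * pairField sWave L) φ).re) -
                  ε * (L : ℝ) ^ 4 ≤
                (expect ((pairField dWaveFormFactor L)ᴴ * pairField dWaveFormFactor L) φ).re +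
                  (expect ((pairField extendedSWave L)ᴴ * pairField extendedSWave L) φ).re := by
  intro hLeak hExo U hU δ hδ
  obtain ⟨η, hη, hLeak⟩ := hLeak U hU δ hδ
  obtain ⟨θ, hθ, hExo⟩ := hExo U hU δ hδ
  refine ⟨4 - η - θ, by linarith, fun ε hε => ?_⟩
  obtain ⟨L₁, h1⟩ := hLeak (ε / 2) (by positivity)
  obtain ⟨L₂, h2⟩ := hExo (ε / 2) (by positivity)
  refine ⟨L₁ + L₂, fun L _ hL hE φ hφ hgs => ?_⟩
  have h1' := h1 L (by omega) hE _ rfl φ hφ hgs _ _ _ rfl rfl rfl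
  have h2' := h2 L (by omega) hE _ rfl φ hφ hgs _ _ _ _ rfl rfl rfl rfl _ _ _ _ rfl rfl rfl rfl
  -- the twin's bond orders are nonnegative
  have hD' := Summit.HubbardSuperconductivity.HubbardSuperconductivity.Theorems.re_expect_pairField_conjTranspose_mul_nonneg
    dWaveFormFactor L (liebVec ⌊(1 - δ) * (L : ℝ) ^ 2 / 2⌋₊ (CFC.abs (liebW ⌊(1 - δ) * (L : ℝ) ^ 2 / 2⌋₊ φ)))
  have hX' := Summit.HubbardSuperconductivity.HubbardSuperconductivity.Theorems.re_expect_pairField_conjTranspose_mul_nonneg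
    extendedSWave L (liebVec ⌊(1 - δ) * (L : ℝ) ^ 2 / 2⌋₊ (CFC.abs (liebW ⌊(1 - δ) * (L : ℝ) ^ 2 / 2⌋₊ φ)))
  -- channel completeness, for the state and for the twin
  have hW := stub_channelCompleteness L ⌊(1 - δ) * (L : ℝ) ^ 2 / 2⌋₊ (liebW ⌊(1 - δ) * (L : ℝ) ^ 2 / 2⌋₊ φ)ᴴ
    (liebW ⌊(1 - δ) * (L : ℝ) ^ 2 / 2⌋₊ φ)
  have hA := stub_channelCompleteness L ⌊(1 - δ) * (L : ℝ) ^ 2 / 2⌋₊ (CFC.abs (liebW ⌊(1 - δ) * (L : ℝ) ^ 2 / 2⌋₊ φ))ᴴ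
    (CFC.abs (liebW ⌊(1 - δ) * (L : ℝ) ^ 2 / 2⌋₊ φ))
  simp only [Finset.sum_sub_distrib, Complex.sub_re] at h1' h2'
  rw [hW, hA] at h2'
  linarith

end Summit.HubbardSuperconductivity.HubbardSuperconductivity.Theorems.LiebTwinChannelExhaustion

end
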